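import Literature.NumberTheory.EllipticCurves.BSDRootNumber
import Literature.NumberTheory.EllipticCurves.RootNumberProductFormulaBCDTProofs
import HarnessLib

/-!
# bsd.S36 product formula `w(E) = −∏_p w_p(E)`: its trust base in the tree, in `bsd` names

A `…Proofs` sibling of `Literature.NumberTheory.EllipticCurves.BSDRootNumber` (theorems only: no
definition, no named fact, no instance; no statement of `BSDRootNumber` is changed).

`BSDRootNumber` lists, for `W : WeierstrassCurve ℚ`, the **bsd.S36 product formula**
`rootNumber_eq_neg_finprod_localRootNumberAt`: for elliptic `W / ℚ` with no additive reduction at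
the places above `2, 3` (where the prelude's `localRootNumber` is the documented junk value `0`),
the analytic root number `W.rootNumber` (the sign of the functional equation of the entire
continuation of `N_W^{s/2}(2π)^{-s}Γ(s)L(E,s)`) equals `−∏ᶠ_v W.localRootNumberAt v`
(Kellock–Dokchitser 2023, Def. 2.1, p. 7: "The global root number `w(E/K) ∈ {±1}` is defined as
the product of local root numbers `w(E/K_v) ∈ {±1}`, `w(E/K) = ∏_v w(E/K_v)`, where the product
runs over all places `v` of `K`, including infinite ones", with `w(E/ℝ) = −1`, Thm. 2.3, and §1.1,
p. 3: "the completed `L`-function has analytic continuation to the whole of the complex plane and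
satisfies the functional equation `L̂(E/K,s) = w(E/K) L̂(E/K,2−s)`, where `w(E/K)` is the global
root number" — a theorem for `K = ℚ` by modularity; the local root numbers are Deligne's local
constants of the Weil–Deligne representations of `E`, Deligne 1973, and their values are
Rohrlich's case list, Kellock–Dokchitser Thm. 2.3).

That statement **is** the prelude named fact `WeierstrassCurve.rootNumber_eq_algebraicRootNumber`
(`Literature.NumberTheory.EllipticCurves.RootNumber`): `W.algebraicRootNumber = −∏ᶠ_v
W.localRootNumberAt v` holds by `rfl` (`algebraicRootNumber_def`), and both carry the same
hypotheses (`[W.IsElliptic]`, no additive reduction above `2, 3`). One published theorem is one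
named fact: the `bsd` inventory entry is derived from the prelude fact (D-0026 review of
2026-08-15: the former verbatim duplicate `def` merged into
`WeierstrassCurve.rootNumber_eq_algebraicRootNumber`), and this file records, in `bsd` names and
with the displayed formula as conclusion, the reductions already landed for the prelude fact
(`RootNumberProductFormulaProofs`, `RootNumberProductFormulaBCDTProofs`):

* `rootNumber_eq_neg_finprod_localRootNumberAt_of_exists_isNewformOf` — the bsd.S36 formula from
  exactly two named facts: the Modularity Theorem, Version `L`
  (`Literature.NumberTheory.EllipticCurves.ModularForms.exists_isNewformOf`; Breuil–Conrad–Diamond–Taylor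
  2001, Thm. A, at level the conductor) and the local product formula for the Fricke sign
  `WeierstrassCurve.frickeEigenvalue_eq_finprod_localRootNumberAt` (`ε(f_E) = ∏ᶠ_v w_v(E)`;
  Kellock–Dokchitser 2023, Rem. 2.2, p. 7: "For an elliptic curve defined over `ℚ`, the local root
  number at a prime `p` agrees with the eigenvalue of the associated Atkin-Lehner involution for
  the associated modular form. This follows from the corresponding statement for modular forms
  … together with the local Langlands conjecture for `GL₂` and the modularity of elliptic curves
  over `ℚ`"); Hecke's functional equation for newforms and Atkin–Lehner's `ε(f) = ±1` are theorems
  of the tree (`IsNewform0.exists_functional_equation_holds`,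
  `IsNewform0.frickeEigenvalue_eq_one_or_eq_neg_one_holds`);
* `rootNumber_eq_neg_finprod_localRootNumberAt_of_theoremB_of_CDT` — trust base
  {BCDT Thm. B, CDT Thm. 7.2.4, `frickeEigenvalue_eq_finprod_localRootNumberAt`}.

## What remains undischarged

The unconditional formula would be
`rootNumber_eq_neg_finprod_localRootNumberAt_of_exists_isNewformOf W exists_isNewformOf_holds
frickeEigenvalue_eq_finprod_localRootNumberAt_holds`: the Modularity Theorem (Wiles 1995;
Taylor–Wiles 1995; Breuil–Conrad–Diamond–Taylor 2001) and the local–global compatibility of the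
attached newform with Deligne's local constants (Carayol; local Langlands for `GL₂`; Rohrlich's
evaluation), neither formalised in the tree; equivalently the single discharge
`WeierstrassCurve.rootNumber_eq_algebraicRootNumber_holds` of the prelude fact. The statement is
not provable short of these inputs: `W.rootNumber` is the *analytic* sign (junk `1` when no
functional equation exists), so even the existence of the functional equation enters only through
modularity.

## References

* [KellockDokchitser2023] L. Cowland Kellock, V. Dokchitser, *Root numbers and parity phenomena*,
  Bull. Lond. Math. Soc. 55 (2023), 2557–2597, §1.1 (p. 3), Def. 2.1, Rem. 2.2, Thm. 2.3 (pp. 7–8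
  of the held copy `paper:arxiv-2303.07883`).
* [DeligneAntwerpII1973] P. Deligne, *Les constantes des équations fonctionnelles des fonctions
  `L`*, Modular Functions of One Variable II, LNM 349 (1973), 501–597 (not held; acquisition
  requested).
* [Rohrlich1994CRM] D. Rohrlich, *Elliptic curves and the Weil–Deligne group*, CRM Proc. Lecture
  Notes 4 (1994), §§19–21.
* [BCDTJAMS2001] C. Breuil, B. Conrad, F. Diamond, R. Taylor, *On the modularity of elliptic curves
  over `ℚ`*, J. Amer. Math. Soc. 14 (2001), Thm. A, Thm. B (= Thm. 2.2.1).
* [ConradDiamondTaylor1999] B. Conrad, F. Diamond, R. Taylor, J. Amer. Math. Soc. 12 (1999),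
  Thm. 7.2.4.
-/

noncomputable section

namespace Literature.NumberTheory.EllipticCurves

open Literature.NumberTheory.EllipticCurves.ModularForms Literature.NumberTheory.Automorphic.BCDT
  IsDedekindDomain

variable (W : WeierstrassCurve ℚ)

/-- **The bsd.S36 product formula `w(E) = −∏_p w_p(E)` from the Modularity Theorem, Version `L`,
and the local product formula for the Fricke sign only.** For an elliptic `W / ℚ` with no additive
reduction at the places above `2, 3`, `W.rootNumber = −∏ᶠ_v W.localRootNumberAt v` follows from
`exists_isNewformOf` (BCDT 2001, Thm. A, at level the conductor; Diamond–Shurman Thm. 8.8.3) and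
`W.frickeEigenvalue_eq_finprod_localRootNumberAt` (`ε(f_E) = ∏ᶠ_v w_v(E)`; Kellock–Dokchitser
2023, Rem. 2.2: local root numbers = Atkin–Lehner eigenvalues, via local Langlands for `GL₂` and
modularity), through `WeierstrassCurve.rootNumber_eq_algebraicRootNumber_of_exists_isNewformOf`
(`RootNumberProductFormulaBCDTProofs`: Hecke's functional equation with sign `−ε(f)`, uniqueness of
the sign since `Λ(E, ·) ≢ 0`, Atkin–Lehner's `ε(f) = ±1`, all proved in the tree) and
`W.algebraicRootNumber = −∏ᶠ_v W.localRootNumberAt v` (`algebraicRootNumber_def`, `rfl`).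
[cite: KellockDokchitser2023, Def. 2.1 and Rem. 2.2 (p. 7)] [cite: BCDTJAMS2001, Thm. A] -/
theorem rootNumber_eq_neg_finprod_localRootNumberAt_of_exists_isNewformOf
    (hmod : exists_isNewformOf) (hloc : W.frickeEigenvalue_eq_finprod_localRootNumberAt)
    [W.IsElliptic]
    (h23 : ∀ v : HeightOneSpectrum ℤ, W.HasAdditiveReductionAt v → 3 < ringChar (ℤ ⧸ v.asIdeal)) :
    W.rootNumber = -∏ᶠ v : HeightOneSpectrum ℤ, W.localRootNumberAt v :=
  W.rootNumber_eq_algebraicRootNumber_of_exists_isNewformOf hmod hloc h23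

/-- **The bsd.S36 product formula from BCDT Theorem B, CDT Theorem 7.2.4 and the local product
formula.** Breuil–Conrad–Diamond–Taylor's Theorem B (`theoremB`, = Thm. 2.2.1) and
Conrad–Diamond–Taylor's Thm. 7.2.4 (`CDT_theorem_7_2_4`) give the Modularity Theorem
`exists_isNewformOf` (`exists_isNewformOf_of_theoremB_of_CDT`), whence the formula by
`rootNumber_eq_neg_finprod_localRootNumberAt_of_exists_isNewformOf`. This theorem records the
trust base {Theorem B, CDT Thm. 7.2.4, `frickeEigenvalue_eq_finprod_localRootNumberAt`} of the
bsd.S36 product formula in the tree (Kellock–Dokchitser 2023, Def. 2.1 and Rem. 2.2).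
[cite: BCDTJAMS2001, Theorem 2.2.1 and Theorem 2.2.2] [cite: KellockDokchitser2023, Def. 2.1 and Rem. 2.2 (p. 7)] -/
theorem rootNumber_eq_neg_finprod_localRootNumberAt_of_theoremB_of_CDT (hB : theoremB)
    (hCDT : CDT_theorem_7_2_4) (hloc : W.frickeEigenvalue_eq_finprod_localRootNumberAt)
    [W.IsElliptic]
    (h23 : ∀ v : HeightOneSpectrum ℤ, W.HasAdditiveReductionAt v → 3 < ringChar (ℤ ⧸ v.asIdeal)) :
    W.rootNumber = -∏ᶠ v : HeightOneSpectrum ℤ, W.localRootNumberAt v :=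
  rootNumber_eq_neg_finprod_localRootNumberAt_of_exists_isNewformOf W
    (exists_isNewformOf_of_theoremB_of_CDT hB hCDT) hloc h23

end Literature.NumberTheory.EllipticCurves

end
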